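import Summits.QuantumFields.YangMills.Theorems.BalabanUVNodesPortS1QtCDtUniform

/-!
# Port S1, socket (o1) → (o3) inputs — THE LINEARISING CHANGE OF VARIABLES `Φ(B) = B − h_ℂ D̃(B)` AT THE RECORD: injective on the ball, onto the half-ball with explicit inverse
# `Ψ(B′) = B′ + h_ℂ C̃_ℂ(B′)`, `D̃` holomorphic along complex lines, `‖D̃ − C̃‖ ≤ 36C₂²b‖B‖³` — lit ✓`B12Lineariz267` §2–§3 BY NAME at (`recordCtC`, `hopLinGraphC`)

Cell `ym-nodeO-ideate`, porter seat PT-A-1 (gen 9); `--kind proof --supports stmt-QuantumFields-27930 --as helper`; count-neutral.  [I] = [Balaban1987RG1]; [15] = [Balaban1985Variational].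

WHY.  Print (2.12)–(2.13) p.268 integrates over `B′ = B − hD̃(B)` («a translation in the space of field configurations»); the fluctuation integral of DEF-1's stage 2 (`recordFluctInt`) and (o3)'s
`Tr log(1 − h δD̃∕δB)` need: `Φ` is a bijection between explicit balls with inverse `Ψ`, and `D̃` is analytic.  Stated for ANY solution family `Dt` in the ball (so that they apply verbatim to the
name `recordDt` of ✓∕⧗`…PortS1RecordDt` and to DEF-1's consumers), under the (o1-ε) letters.

WHAT IS PROVED (all by name over lit ✓`B12Lineariz267` + (o1-β)₂ ✓`quadAnalytic_recordCtC` + ✓`differentiableOn_recordQtC_ball`):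
* §1 `differentiableOn_recordCtC_ball` — `C̃_ℂ(Vk)` is Fréchet-holomorphic on `‖Y‖ < R` (the `hCd` input of lit `differentiableOn_Dt_line`).
* §2 ★★ `differentiableOn_recordDt_line` — «D̃ is an analytic function of B» along every complex line `σ ↦ P + σQ` inside `‖·‖ < ρ`.
* §3 ★ `mapsTo_recordPhi` (`Φ : ball ρ → ball 2ρ`), ★ `injOn_recordPhi_ball`, `recordPsi_mem_of_norm_lt`, `recordDt_recordPsi` (`D̃(Ψ B′) = C̃ B′`), ★★ `recordPhi_recordPsi_of_norm_lt` (`Φ(Ψ B′) = B′` for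
  `‖B′‖ < ρ∕2`), `ball_half_subset_image_recordPhi`, ★ `existsUnique_recordPhi_eq`, `norm_recordDt_sub_recordCtC_le` (`‖D̃(B) − C̃(B)‖ ≤ 36C₂²b‖B‖³`).

HONEST FRAMING.  Transcriptions by name; JOINT analyticity of `D̃` in `B` is not typed (line-holomorphy is what (o3)'s contour/Cauchy arguments consume); the Jacobian `det(1 − h δD̃∕δB)` and (o3) proper
NOT here; `stub_FE` (XXL) ∕ `stub_P0C` OPEN, ⟨27930⟩ OPEN (1∕3); NODE O 0∕1; COUNT 8∕28 · K 1∕4 UNMOVED; finite `𝕋⁴_{L^K}` at fixed ε — NOT continuum ∕ OS; **the Yang–Mills mass gap (Clay) is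
NOT proved by any of this.**  No `sorry`; standard axioms only.
-/

noncomputable section

open scoped BigOperators Matrix.Norms.L2Operator Topology

open Set Metric Filter

namespace Summit.QuantumFields.YangMills.Theorems.BalabanUVNodesPortS1

open Summit.QuantumFields.YangMills.Theorems.K0RecordFormatNames
open Literature.MathematicalPhysics.QuantumFieldTheory.Balaban1983to89
open Literature.MathematicalPhysics.QuantumFieldTheory.Balaban1983to89.Node00
open Literature.MathematicalPhysics.QuantumFieldTheory.Balaban1983to89.T4Continuum (T4Family)
open Literature.MathematicalPhysics.QuantumFieldTheory.Balaban1983to89.BlockAveraging (Small Idx)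
open Literature.MathematicalPhysics.QuantumFieldTheory.Balaban1983to89.ExpMeanLog (expMeanLogSU)
open _root_.Matrix

variable (F : T4Family)

/-! ## §1  `C̃_ℂ` is Fréchet-holomorphic on the ball -/

/-- `C̃_ℂ(Vk) = Q̃_ℂ − LQ̃_ℂ` is ℂ-Fréchet-differentiable on `‖Y‖ < R = 1∕(10⁸dL)`. [cite: Balaban1987RG1, p.267 («an analytic function of B»)] -/
theorem differentiableOn_recordCtC_ball (k K : ℕ) (hk : k + 1 ≤ (F.P K).m + (F.P K).K) (Vk : GaugeField (F.P K) k (SU 2)) {ε : ℝ}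
    (hε : ∀ (c : PBond (F.P K) (k + 1)) (i : Idx (F.P K)), ‖loopM (coeField Vk) c i - 1‖ ≤ ε) (hε50 : ε ≤ 1 / 50)
    (hVk : ∀ c, Small expMeanLogSU Vk c) :
    DifferentiableOn ℂ (recordCtC F k K Vk) {Y : FluctIdx F k K → ℂ | ‖Y‖ < 1 / (10 ^ 8 * (F.P K).d * (F.P K).L)} := by
  have hset : {Y : FluctIdx F k K → ℂ | ‖Y‖ < 1 / (10 ^ 8 * (F.P K).d * (F.P K).L)} = ball 0 (1 / (10 ^ 8 * (F.P K).d * (F.P K).L)) := by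
    ext Y; simp
  rw [hset]
  have hQ := differentiableOn_recordQtC_ball F k K hk Vk hε hε50 hVk
  have hC : recordCtC F k K Vk = fun z => recordQtC F k K Vk z - recordLQtC F k K Vk z := rfl
  rw [hC]
  exact hQ.sub (recordLQtC F k K Vk).differentiable.differentiableOn

section Letters

variable {F}
variable {k K : ℕ} (hk : k + 1 ≤ (F.P K).m + (F.P K).K) (Vk : GaugeField (F.P K) k (SU 2)) {ε : ℝ}
  (hε : ∀ (c : PBond (F.P K) (k + 1)) (i : Idx (F.P K)), ‖loopM (coeField Vk) c i - 1‖ ≤ ε) (hε50 : ε ≤ 1 / 50)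
  (hVk : ∀ c, Small expMeanLogSU Vk c) {b ρ : ℝ} (hb : 0 ≤ b) (hHop : ∀ X, ‖hopLinGraphC F k K Vk X‖ ≤ b * ‖X‖)
  (hq : 9 * (2 * 1 / (1 / (10 ^ 8 * (F.P K).d * (F.P K).L)) ^ 2) * b * ρ < 1) (hρ : 3 * ρ ≤ 1 / (10 ^ 8 * (F.P K).d * (F.P K).L))
  {Dt : (FluctIdx F k K → ℂ) → (PBond (F.P K) (k + 1) → MatA 2)}
  (hball : ∀ B, ‖B‖ < ρ → Dt B ∈ closedBall (0 : PBond (F.P K) (k + 1) → MatA 2) (4 * (2 * 1 / (1 / (10 ^ 8 * (F.P K).d * (F.P K).L)) ^ 2) * ρ ^ 2))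
  (hfix : ∀ B, ‖B‖ < ρ → recordCtC F k K Vk (B - hopLinGraphC F k K Vk (Dt B)) = Dt B)

/-! ## §2  `D̃` is holomorphic along complex lines -/

include hk hε hε50 hVk hb hHop hq hρ hball hfix in
/-- ★★ **«D̃ is an analytic function of B» — along every complex line**: for a solution family `Dt` in the ball, `σ ↦ D̃(P + σQ)` is ℂ-differentiable on `{σ : ‖P + σQ‖ < ρ}` (lit
✓`B12Lineariz267.differentiableOn_Dt_line`, its `hCd` by §1). [cite: Balaban1987RG1, p.267; Balaban1985Variational, (96)–(98) p.292] -/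
theorem differentiableOn_recordDt_line (P Q : FluctIdx F k K → ℂ) :
    DifferentiableOn ℂ (fun σ : ℂ => Dt (P + σ • Q)) {σ : ℂ | ‖P + σ • Q‖ < ρ} :=
  B12Lineariz267.differentiableOn_Dt_line (quadAnalytic_recordCtC F k K hk Vk hε hε50 hVk) (by positivity) hb hHop hq hρ
    (differentiableOn_recordCtC_ball F k K hk Vk hε hε50 hVk) hball hfix P Q

/-! ## §3  The change of variables `Φ(B) = B − h_ℂ D̃(B)`, its inverse `Ψ(B′) = B′ + h_ℂ C̃_ℂ(B′)` on the half-ball -/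

include hk hε hε50 hVk hb hHop hq hρ hball hfix in
/-- ★ `Φ` maps the ball `ρ` into the ball `2ρ` (lit `mapsTo_phi`). [cite: Balaban1987RG1, p.267–268] -/
theorem mapsTo_recordPhi :
    MapsTo (fun B => B - hopLinGraphC F k K Vk (Dt B)) (ball (0 : FluctIdx F k K → ℂ) ρ) (ball (0 : FluctIdx F k K → ℂ) (2 * ρ)) :=
  B12Lineariz267.mapsTo_phi (quadAnalytic_recordCtC F k K hk Vk hε hε50 hVk) (by positivity) hb hHop hq hρ hball hfix

include hfix in
/-- ★ `Φ` is injective on the ball `ρ` (lit `injOn_phi_ball`). [cite: Balaban1987RG1, p.267–268] -/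
theorem injOn_recordPhi_ball : InjOn (fun B => B - hopLinGraphC F k K Vk (Dt B)) (ball (0 : FluctIdx F k K → ℂ) ρ) :=
  B12Lineariz267.injOn_phi_ball hfix

include hk hε hε50 hVk hb hHop hq hρ in
/-- For `‖B′‖ < ρ∕2`: `‖Ψ B′‖ < ρ` and `C̃_ℂ B′` lies in the closed ball `4C₂ρ²` (lit `psi_mem_of_norm_lt`). [cite: Balaban1987RG1, p.267–268] -/
theorem recordPsi_mem_of_norm_lt {B' : FluctIdx F k K → ℂ} (hB' : ‖B'‖ < ρ / 2) :
    ‖B' + hopLinGraphC F k K Vk (recordCtC F k K Vk B')‖ < ρ ∧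
      recordCtC F k K Vk B' ∈ closedBall (0 : PBond (F.P K) (k + 1) → MatA 2) (4 * (2 * 1 / (1 / (10 ^ 8 * (F.P K).d * (F.P K).L)) ^ 2) * ρ ^ 2) :=
  B12Lineariz267.psi_mem_of_norm_lt (quadAnalytic_recordCtC F k K hk Vk hε hε50 hVk) (by positivity) hb hHop hq hρ hB'

include hk hε hε50 hVk hb hHop hq hρ hball hfix in
/-- `D̃(Ψ B′) = C̃_ℂ B′` whenever `‖Ψ B′‖ < ρ` and `C̃_ℂ B′` is in the ball (lit `Dt_psi`). [cite: Balaban1987RG1, p.267–268] -/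
theorem recordDt_recordPsi {B' : FluctIdx F k K → ℂ} (hΨ : ‖B' + hopLinGraphC F k K Vk (recordCtC F k K Vk B')‖ < ρ)
    (hCt : recordCtC F k K Vk B' ∈ closedBall (0 : PBond (F.P K) (k + 1) → MatA 2) (4 * (2 * 1 / (1 / (10 ^ 8 * (F.P K).d * (F.P K).L)) ^ 2) * ρ ^ 2)) :
    Dt (B' + hopLinGraphC F k K Vk (recordCtC F k K Vk B')) = recordCtC F k K Vk B' :=
  B12Lineariz267.Dt_psi (quadAnalytic_recordCtC F k K hk Vk hε hε50 hVk) (by positivity) hb hHop hq hρ hball hfix hΨ hCt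

include hk hε hε50 hVk hb hHop hq hρ hball hfix in
/-- ★★ **`Φ ∘ Ψ = id` ON THE HALF-BALL**: for `‖B′‖ < ρ∕2`, `‖Ψ B′‖ < ρ` and `Φ(Ψ B′) = B′` (lit `phi_psi_of_norm_lt`) — «every B′ of the small ball is obtained by the translation».
[cite: Balaban1987RG1, p.267–268] -/
theorem recordPhi_recordPsi_of_norm_lt {B' : FluctIdx F k K → ℂ} (hB' : ‖B'‖ < ρ / 2) :
    ‖B' + hopLinGraphC F k K Vk (recordCtC F k K Vk B')‖ < ρ ∧
      (B' + hopLinGraphC F k K Vk (recordCtC F k K Vk B')) - hopLinGraphC F k K Vk (Dt (B' + hopLinGraphC F k K Vk (recordCtC F k K Vk B'))) = B' :=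
  B12Lineariz267.phi_psi_of_norm_lt (quadAnalytic_recordCtC F k K hk Vk hε hε50 hVk) (by positivity) hb hHop hq hρ hball hfix hB'

include hk hε hε50 hVk hb hHop hq hρ hball hfix in
/-- The half-ball is in the image of the ball under `Φ` (lit `ball_half_subset_image_phi`). [cite: Balaban1987RG1, p.267–268] -/
theorem ball_half_subset_image_recordPhi :
    ball (0 : FluctIdx F k K → ℂ) (ρ / 2) ⊆ (fun B => B - hopLinGraphC F k K Vk (Dt B)) '' ball (0 : FluctIdx F k K → ℂ) ρ :=
  B12Lineariz267.ball_half_subset_image_phi (quadAnalytic_recordCtC F k K hk Vk hε hε50 hVk) (by positivity) hb hHop hq hρ hball hfix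

include hk hε hε50 hVk hb hHop hq hρ hball hfix in
/-- ★ **UNIQUE PREIMAGE**: every `‖B′‖ < ρ∕2` is `Φ(B)` for exactly one `‖B‖ < ρ` (lit `existsUnique_phi_eq`). [cite: Balaban1987RG1, p.267–268] -/
theorem existsUnique_recordPhi_eq {B' : FluctIdx F k K → ℂ} (hB' : ‖B'‖ < ρ / 2) :
    ∃! B : FluctIdx F k K → ℂ, ‖B‖ < ρ ∧ B - hopLinGraphC F k K Vk (Dt B) = B' :=
  B12Lineariz267.existsUnique_phi_eq (quadAnalytic_recordCtC F k K hk Vk hε hε50 hVk) (by positivity) hb hHop hq hρ hball hfix hB'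

include hk hε hε50 hVk hb hHop hq hρ hball hfix in
/-- **«D̃⁽²⁾ = C̃⁽²⁾» as a third-order bound**: `‖D̃(B) − C̃_ℂ(B)‖ ≤ 36C₂²b‖B‖³` for `‖B‖ < ρ` (lit `norm_Dt_sub_Ct_le`). [cite: Balaban1987RG1, (1.5) p.261, p.267] -/
theorem norm_recordDt_sub_recordCtC_le {B : FluctIdx F k K → ℂ} (hB : ‖B‖ < ρ) :
    ‖Dt B - recordCtC F k K Vk B‖ ≤ 36 * (2 * 1 / (1 / (10 ^ 8 * (F.P K).d * (F.P K).L)) ^ 2) ^ 2 * b * ‖B‖ ^ 3 :=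
  B12Lineariz267.norm_Dt_sub_Ct_le (quadAnalytic_recordCtC F k K hk Vk hε hε50 hVk) (by positivity) hb hHop hq hρ hball hfix hB

end Letters

end Summit.QuantumFields.YangMills.Theorems.BalabanUVNodesPortS1

end
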